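import Literature.NumberTheory.Rogawski1990.UnitStableOrbitalIntegralCyclicFrameAffine              -- ★ p851800 (P5d): affine frame socket at `w` (brings ★ B-p10's value file, ★ FILE A, ★ (A1))
import Literature.NumberTheory.Rogawski1990.UnitStableOrbitalIntegralCyclicFrameAffineCentreBound   -- ★ p851838: `valuation_antidiagTrace_le_of_affine` (`hβa′` from frame + admissibility)
import Literature.NumberTheory.Automorphic.PlaneLatticesCompanionAffineSelfDualCount               -- ★ p851830 (P5c) part II: `ncard_selfDualStable_antidiag_companion_affine_eq_sum`
import HarnessLib

/-!
# The TYPE-(2) H-side value at EVERY inert place: `Φ(⟦γ_H⟧, 1_{K_H}) = phiHtwo q j = (q^{j+1} − 1)∕(q − 1)` for an admissible Eisenstein centre — the `|2|`-free twin of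
# ★ `UnitStableOrbitalIntegralHSideValueTypeTwo` (Flicker 1998, p. 97)

Topic `NumberTheory/Rogawski1990`; namespace `Literature.NumberTheory.Automorphic.UnitaryGroup`.  THEOREMS ONLY (no definition, no instance, no notation, no named
fact, no `sorry`).  Cell `pub/hodgecm-mathlib`, F0∕P3c LH4 list M6 row «B-p10″ HEAD» (LH4-plan (g6) WORD #73∕#90∕#116∕#121; B-p08 (g40) M6 memo §4–§5; LH5-p01 (g5) (P5c)).
HC_CM is proved only modulo the printed citations (hLiu418 = stmt-HodgeConjecture-24832, h413 = stmt-HodgeConjecture-24833) until rung 0 closes; this file is the dyadic-capable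
payer of the type-(2) value stub, modulo the same ONE named binder as ★ B-p10 (`[CompactSpace Z(γ₂)]`), and reads NO hypothesis on `|2|`.

THE DICTIONARY `N ↦ j`, `tr∕2 ↦ a`.  ★ B-p10 proves `#S((Φ₂)_w, γ) = Σ_{k ≤ N} q^k` from `|2|_w = 1`, `|tr² − 4det| = exp(−(2N+1))`, reducing at the centre `tr∕2`.  Here the
centre is an ADMISSIBLE EISENSTEIN CENTRE `(a, f, e′, j)`: `a ∈ 𝒪_w`, `tr − 2a = f`, `a² − tr·a + det = −e′`, `|f| ≤ |ϖ^(j+1)|`, `|e′| = |ϖ^(2j+1)|` — at `v ∤ 2` one takes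
`a = tr∕2`, `f = 0`, `e′ = (tr² − 4det)∕4`, `j = N`; at `v ∣ 2` it is the `1`-coordinate of the eigenvalue in the wild Eisenstein frame (★ p851792 ∕ ★ p851827 dictionary:
`a = (t+y)e₂`, `f = −y`, `e′ = y²w₀e₂²`).  The proof is the composition of ★ sockets: (A1) the Eisenstein relation `(g − a·1)² = f·(g − a·1) + e′·1`; ★ p851800 the affine
isotropic cyclic frame (`#S((Φ₂)_w, g) = #S(!![0,β;σβ,0], C(t,d))`, `|det| = 1`, `d·σβ = −β`, `β·σt + σβ·t = 0`, the transported relation); ★ p851838 the centre-trace bound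
`|β·σa + σβ·a| ≤ |ϖ^(j+1+e)|` (automatic: frame + admissibility, parity lemma ★ p851805); ★ p851830 the Eisenstein-centred count `Σ_{k ≤ j} q^k`; ★ p840855 PAIR ∕ lattice
sockets and `phiHtwo` (★ B-p14) as in ★ B-p10 §4.

* §2 `ncard_selfDualStable_antidiag_companion_affine_eq_sum_at` — ★ p851830 at `w` (inert instance block).
* §3 **`ncard_selfDualStable_antidiagTwo_eq_sum_of_unitary_admissible`** (binders `hg10` + scalar admissibility only; ★ p851884's `…_of_unitary_affine` is the variant with `hirr`, `hk`, `hga′`),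
  **`ncard_selfDualStable_antidiagTwo_eq_sum_of_not_exists_isRoot_affine`** — `#S((Φ₂)_w, γ) = Σ_{k ≤ j} q_v^k`.
* §4 **`classOrbitalIntegral_indicator_eq_phiHtwo_of_not_exists_isRoot_affine`** — the value, in the stub frame minus `h2`, `hint`, `(N, hN)`, plus `(a, f, e′, j)`.

## References
* [Flicker1998UnitaryFL] Y. Z. Flicker, *Elementary proof of the fundamental lemma for a unitary group*, Canad. J. Math. 50 (1998), §6 p. 95 REMARK, p. 97.
* [Rogawski1990] J. D. Rogawski, *Automorphic Representations of Unitary Groups in Three Variables* (1990), §4.9 Prop. 4.9.1 (b) p. 55; §3.6 p. 31.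
* [Serre1979] J.-P. Serre, *Local Fields*, GTM 67 (1979), Ch. I §6; Ch. V §2.
* [NeukirchANT1999] J. Neukirch, *Algebraic Number Theory* (1999), Ch. I §3.
-/

set_option autoImplicit false

noncomputable section

open MeasureTheory NumberField IsDedekindDomain Matrix Finset ValuativeRel
open scoped ValuativeRel Matrix MatrixGroups

namespace Literature.NumberTheory.Automorphic.UnitaryGroup

open Literature.NumberTheory.Rogawski1990

/-! ## §2 The Eisenstein-centred count at `w` -/

section AtPlace

variable (L : Type) [Field L] [NumberField L] [IsCMField L] (v : HeightOneSpectrum (𝓞 ↥(maximalRealSubfield L)))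
  (w : PlacesOver L v) (hw : IsCMField.complexConj L • w.1 = w.1)

include hw in
/-- **THE EISENSTEIN-CENTRED TYPE-(2) COUNT AT `w`** — ★ (P5c) part II `ncard_selfDualStable_antidiag_companion_affine_eq_sum` at `F := L_w`, `σ := σ_w`, `ϖ := ι_w(ϖ_v)`:
for `t, d, β ∈ L_w` with `|d| = 1`, `|β| = |ϖ^e|` (`e ≤ 1`), an admissible centre `(a, f, e′)` (`a ∈ 𝒪`, `|f| ≤ |ϖ^(j+1)|`, `|e′| = |ϖ^(2j+1)|`,
`(↑γ − a·1)² = f·(↑γ − a·1) + e′·1`) with `|β·σa + σβ·a| ≤ |ϖ^(j+1+e)|`, and `↑γ = !![0, −d; 1, t]`: `#S(!![0, β; σβ, 0], γ) = Σ_(k ≤ j) q_v^k` — NO `|2| = 1`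
(`|𝓀_w| = q_v²`, `σ_w` moves an integer by a unit — the inert instance block of ★ p840855 ∕ ★ B-p10 §2 verbatim). [cite: Flicker1998UnitaryFL, §6 p. 97] [cite: Serre1979, Ch. V §2] -/
theorem ncard_selfDualStable_antidiag_companion_affine_eq_sum_at (hunr : Algebra.IsUnramifiedIn (𝓞 L) v.asIdeal)
    {t d β : (w.1.adicCompletion L)} (hd : valuation (w.1.adicCompletion L) d = 1)
    {e : ℕ} (he : e ≤ 1) (hβ : valuation (w.1.adicCompletion L) β = valuation (w.1.adicCompletion L) ((toPlace v w (GaloisRepresentations.HeckeCharacter.uniformizer ↥(maximalRealSubfield L) v : v.adicCompletion ↥(maximalRealSubfield L))) ^ e)) {j : ℕ}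
    (γ : GL (Fin 2) (w.1.adicCompletion L)) (hγ : (γ : Matrix (Fin 2) (Fin 2) (w.1.adicCompletion L)) = !![0, -d; 1, t])
    {a f e' : (w.1.adicCompletion L)} (haO : a ∈ 𝒪[(w.1.adicCompletion L)])
    (hf : valuation (w.1.adicCompletion L) f ≤ valuation (w.1.adicCompletion L) ((toPlace v w (GaloisRepresentations.HeckeCharacter.uniformizer ↥(maximalRealSubfield L) v : v.adicCompletion ↥(maximalRealSubfield L))) ^ (j + 1)))
    (hj : valuation (w.1.adicCompletion L) e' = valuation (w.1.adicCompletion L) ((toPlace v w (GaloisRepresentations.HeckeCharacter.uniformizer ↥(maximalRealSubfield L) v : v.adicCompletion ↥(maximalRealSubfield L))) ^ (2 * j + 1)))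
    (hγa : ((γ : Matrix (Fin 2) (Fin 2) (w.1.adicCompletion L)) - a • (1 : Matrix (Fin 2) (Fin 2) (w.1.adicCompletion L))) * ((γ : Matrix (Fin 2) (Fin 2) (w.1.adicCompletion L)) - a • (1 : Matrix (Fin 2) (Fin 2) (w.1.adicCompletion L))) =
      f • ((γ : Matrix (Fin 2) (Fin 2) (w.1.adicCompletion L)) - a • (1 : Matrix (Fin 2) (Fin 2) (w.1.adicCompletion L))) + e' • (1 : Matrix (Fin 2) (Fin 2) (w.1.adicCompletion L)))
    (hβa' : valuation (w.1.adicCompletion L) (β * (galAdicCompletionMap (L := L) (IsCMField.complexConj L) hw) a + (galAdicCompletionMap (L := L) (IsCMField.complexConj L) hw) β * a) ≤ valuation (w.1.adicCompletion L) ((toPlace v w (GaloisRepresentations.HeckeCharacter.uniformizer ↥(maximalRealSubfield L) v : v.adicCompletion ↥(maximalRealSubfield L))) ^ (j + 1 + e))) :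
    {Λ : Submodule 𝒪[(w.1.adicCompletion L)] (Fin 2 → (w.1.adicCompletion L)) |
        (∃ g : GL (Fin 2) (w.1.adicCompletion L), (∃ J' ∈ glInt 2 (w.1.adicCompletion L), (J' : Matrix (Fin 2) (Fin 2) (w.1.adicCompletion L)) =
            formCongr (galAdicCompletionMap (L := L) (IsCMField.complexConj L) hw) g (!![0, β; (galAdicCompletionMap (L := L) (IsCMField.complexConj L) hw) β, 0] : Matrix (Fin 2) (Fin 2) (w.1.adicCompletion L))) ∧
          Λ = Submodule.span 𝒪[(w.1.adicCompletion L)] (Set.range ((g : Matrix (Fin 2) (Fin 2) (w.1.adicCompletion L)))ᵀ)) ∧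
        Λ.map ((Matrix.toLin' (γ : Matrix (Fin 2) (Fin 2) (w.1.adicCompletion L))).restrictScalars 𝒪[(w.1.adicCompletion L)]) = Λ}.ncard =
      ∑ k ∈ range (j + 1), Nat.card (𝓞 ↥(maximalRealSubfield L) ⧸ v.asIdeal) ^ k := by
  classical
  have hc1 : IsCMField.complexConj L ≠ 1 := IsCMField.complexConj_ne_one L
  have hϖv := Liu2021.LemD1IndexedNonVacuityInertCofinite.valued_toPlace_uniformizer_of_isUnramifiedIn L v hunr w
  have hϖ : IsUniformizingElement (toPlace v w (GaloisRepresentations.HeckeCharacter.uniformizer ↥(maximalRealSubfield L) v : v.adicCompletion ↥(maximalRealSubfield L))) := isUniformizingElement_of_v_eq hϖv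
  haveI : IsDiscreteValuationRing 𝒪[(w.1.adicCompletion L)] := isDiscreteValuationRing_integer_of_compatible hϖv
  have hσO : ∀ x : 𝒪[(w.1.adicCompletion L)], (galAdicCompletionMap (L := L) (IsCMField.complexConj L) hw) x ∈ 𝒪[(w.1.adicCompletion L)] := mem_integer_galAdicCompletionMap (IsCMField.complexConj L) v w hw
  let σO : 𝒪[(w.1.adicCompletion L)] →+* 𝒪[(w.1.adicCompletion L)] := ((galAdicCompletionMap (L := L) (IsCMField.complexConj L) hw).comp (𝒪[(w.1.adicCompletion L)]).subtype).codRestrict 𝒪[(w.1.adicCompletion L)] fun x => hσO x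
  have hσO' : ∀ x : 𝒪[(w.1.adicCompletion L)], ((σO x : 𝒪[(w.1.adicCompletion L)]) : (w.1.adicCompletion L)) = (galAdicCompletionMap (L := L) (IsCMField.complexConj L) hw) x := fun _ => rfl
  have hσσ : ∀ x, σO (σO x) = x := fun x =>
    Subtype.ext (galAdicCompletionMap_galAdicCompletionMap_of_smul_eq (IsCMField.complexConj L) w hc1 hw (x : (w.1.adicCompletion L)))
  have hσϖ : (galAdicCompletionMap (L := L) (IsCMField.complexConj L) hw) (toPlace v w (GaloisRepresentations.HeckeCharacter.uniformizer ↥(maximalRealSubfield L) v : v.adicCompletion ↥(maximalRealSubfield L))) = (toPlace v w (GaloisRepresentations.HeckeCharacter.uniformizer ↥(maximalRealSubfield L) v : v.adicCompletion ↥(maximalRealSubfield L))) := galAdicCompletionMap_toPlace (IsCMField.complexConj L) w w hw _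
  have hσv : ∀ x, valuation (w.1.adicCompletion L) ((galAdicCompletionMap (L := L) (IsCMField.complexConj L) hw) x) = valuation (w.1.adicCompletion L) x := fun x => valuation_galAdicCompletionMap_eq (IsCMField.complexConj L) v w hw x
  obtain ⟨σk, hσk⟩ := exists_residueField_ringHom_galAdicCompletionMap (IsCMField.complexConj L) v w hw
  have hq : Nat.card 𝓀[(w.1.adicCompletion L)] = Nat.card (𝓞 ↥(maximalRealSubfield L) ⧸ v.asIdeal) ^ 2 := natCard_residueField_eq_sq_of_inert (IsCMField.complexConj L) v hc1 hunr w hw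
  letI : Fintype 𝓀[(w.1.adicCompletion L)] := Fintype.ofFinite _
  have hq' : Fintype.card 𝓀[(w.1.adicCompletion L)] = Nat.card (𝓞 ↥(maximalRealSubfield L) ⧸ v.asIdeal) ^ 2 := by rw [← Nat.card_eq_fintype_card, hq]
  obtain ⟨a₀, ha₀⟩ := LocalFields.UnramifiedQuadraticNorm.exists_isUnit_map_sub_of_residueHom_ne (galAdicCompletionMap (L := L) (IsCMField.complexConj L) hw) hσO σk hσk
    (Literature.LinearAlgebra.Matrix.exists_frob_ne hq' σk (residueHom_galAdicCompletionMap_eq_pow (IsCMField.complexConj L) v hc1 hunr w hw σk hσO hσk))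
  have ha₀' : IsUnit (σO a₀ - a₀) := ha₀
  exact ncard_selfDualStable_antidiag_companion_affine_eq_sum hϖ (galAdicCompletionMap (L := L) (IsCMField.complexConj L) hw) σO hσO' hσσ hσϖ hσv hd he hβ γ hγ haO hf hj hγa hβa' ha₀' hq

end AtPlace

/-! ## §3 From a unitary matrix ∕ a type-(2) element to the companion count -/

section Value

variable (L : Type) [Field L] [NumberField L] [IsCMField L] (v : HeightOneSpectrum (𝓞 ↥(maximalRealSubfield L)))
  (w : PlacesOver L v) (hw : IsCMField.complexConj L • w.1 = w.1)

omit [IsCMField L] in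
/-- `(Φ₂)_w = !![0, 1; 1, 0]` (entries `0, 1` under `algebraMap`). [folklore] -/
private theorem placeForm_antidiagTwo_eq_aff :
    placeForm (Matrix.of fun i j : Fin 2 => if i.val + j.val + 1 = 2 then (1 : L) else 0) w.1 = (!![0, 1; 1, 0] : Matrix (Fin 2) (Fin 2) (w.1.adicCompletion L)) := by
  ext i j
  fin_cases i <;> fin_cases j <;> simp [placeForm, Matrix.map_apply]

include hw in
/-- **THE COUNT AT THE PLACE `w` FOR A UNITARY MATRIX WITH AN ADMISSIBLE EISENSTEIN CENTRE** (no `|2| = 1`): for `g ∈ GL₂(L_w)` unitary for `(Φ₂)_w = !![0,1;1,0]` with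
`g₁₀ ≠ 0`, and scalars `(a, f, e′)` with `a ∈ 𝒪`, `tr g − 2a = f`, `a² − tr g·a + det g = −e′`, `|f| ≤ |ϖ^(j+1)|`, `|e′| = |ϖ^(2j+1)|`: `#S((Φ₂)_w, g) = Σ_(k ≤ j) q_v^k`.
Road: the Eisenstein relation `(g − a·1)² = f·(g − a·1) + e′·1` (★ (A1)), the affine frame socket ★ p851800 `exists_antidiag_companion_affine_frame_ncard_eq_of_unitary`
(`β, e, γ′`, `|det g| = 1`, `d·σβ = −β`, `β·σt + σβ·t = 0`, the transported relation, `#S((Φ₂)_w, g) = #S(!![0,β;σβ,0], γ′)`), the centre-trace bound ★ p851838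
`valuation_antidiagTrace_le_of_affine` (`hβa′` from frame + admissibility), and §2.  At `v ∤ 2` with `a = t∕2`, `f = 0`, `e′ = (t² − 4d)∕4` this is ★ B-p10 §3.
(★ p851884 `ncard_selfDualStable_antidiagTwo_eq_sum_of_unitary_affine` is the variant with binders `hirr`, the matrix relation `hk` and a centre-trace bound `hga′`; here `hga′`
is discharged by ★ p851838 and only `g₁₀ ≠ 0` and the scalar admissibility data are read.) [cite: Flicker1998UnitaryFL, §6 p. 97] [cite: Rogawski1990, §3.6 p. 31] -/
theorem ncard_selfDualStable_antidiagTwo_eq_sum_of_unitary_admissible (hunr : Algebra.IsUnramifiedIn (𝓞 L) v.asIdeal)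
    (gGL : GL (Fin 2) (w.1.adicCompletion L)) (g : Matrix (Fin 2) (Fin 2) (w.1.adicCompletion L)) (hcoe : (gGL : Matrix (Fin 2) (Fin 2) (w.1.adicCompletion L)) = g)
    (hgU : (g.map (galAdicCompletionMap (L := L) (IsCMField.complexConj L) hw))ᵀ * (!![0, 1; 1, 0] : Matrix (Fin 2) (Fin 2) (w.1.adicCompletion L)) * g = !![0, 1; 1, 0])
    (hg10 : g 1 0 ≠ 0) {a f e' : (w.1.adicCompletion L)} (haO : a ∈ 𝒪[(w.1.adicCompletion L)]) {j : ℕ}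
    (hf : valuation (w.1.adicCompletion L) f ≤ valuation (w.1.adicCompletion L) ((toPlace v w (GaloisRepresentations.HeckeCharacter.uniformizer ↥(maximalRealSubfield L) v : v.adicCompletion ↥(maximalRealSubfield L))) ^ (j + 1)))
    (hj : valuation (w.1.adicCompletion L) e' = valuation (w.1.adicCompletion L) ((toPlace v w (GaloisRepresentations.HeckeCharacter.uniformizer ↥(maximalRealSubfield L) v : v.adicCompletion ↥(maximalRealSubfield L))) ^ (2 * j + 1)))
    (htf : g.trace - 2 * a = f) (hde : a * a - g.trace * a + g.det = -e') :
    {Λ : Submodule 𝒪[(w.1.adicCompletion L)] (Fin 2 → (w.1.adicCompletion L)) |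
        (∃ g' : GL (Fin 2) (w.1.adicCompletion L), (∃ J' ∈ glInt 2 (w.1.adicCompletion L), (J' : Matrix (Fin 2) (Fin 2) (w.1.adicCompletion L)) =
            formCongr (galAdicCompletionMap (L := L) (IsCMField.complexConj L) hw) g' (placeForm (Matrix.of fun i j : Fin 2 => if i.val + j.val + 1 = 2 then (1 : L) else 0) w.1)) ∧
          Λ = Submodule.span 𝒪[(w.1.adicCompletion L)] (Set.range ((g' : Matrix (Fin 2) (Fin 2) (w.1.adicCompletion L)))ᵀ)) ∧
        Λ.map ((Matrix.toLin' ((gGL : GL (Fin 2) (w.1.adicCompletion L)) : Matrix (Fin 2) (Fin 2) (w.1.adicCompletion L))).restrictScalars 𝒪[(w.1.adicCompletion L)]) = Λ}.ncard =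
      ∑ k ∈ range (j + 1), Nat.card (𝓞 ↥(maximalRealSubfield L) ⧸ v.asIdeal) ^ k := by
  classical
  have hc1 : IsCMField.complexConj L ≠ 1 := IsCMField.complexConj_ne_one L
  have hϖv := Liu2021.LemD1IndexedNonVacuityInertCofinite.valued_toPlace_uniformizer_of_isUnramifiedIn L v hunr w
  have hϖ : IsUniformizingElement (toPlace v w (GaloisRepresentations.HeckeCharacter.uniformizer ↥(maximalRealSubfield L) v : v.adicCompletion ↥(maximalRealSubfield L))) := isUniformizingElement_of_v_eq hϖv
  have h0 := hϖ.ne_zero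
  haveI : IsDiscreteValuationRing 𝒪[(w.1.adicCompletion L)] := isDiscreteValuationRing_integer_of_compatible hϖv
  have hσv : ∀ x, valuation (w.1.adicCompletion L) ((galAdicCompletionMap (L := L) (IsCMField.complexConj L) hw) x) = valuation (w.1.adicCompletion L) x := fun x => valuation_galAdicCompletionMap_eq (IsCMField.complexConj L) v w hw x
  have hσσ : ∀ x, (galAdicCompletionMap (L := L) (IsCMField.complexConj L) hw) ((galAdicCompletionMap (L := L) (IsCMField.complexConj L) hw) x) = x := fun x => galAdicCompletionMap_galAdicCompletionMap_of_smul_eq (IsCMField.complexConj L) w hc1 hw x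
  -- the Eisenstein relation of `g` at the centre `a` (★ (A1))
  have hk : (g - a • (1 : Matrix (Fin 2) (Fin 2) (w.1.adicCompletion L))) * (g - a • (1 : Matrix (Fin 2) (Fin 2) (w.1.adicCompletion L))) =
      f • (g - a • (1 : Matrix (Fin 2) (Fin 2) (w.1.adicCompletion L))) + e' • (1 : Matrix (Fin 2) (Fin 2) (w.1.adicCompletion L)) := by
    rw [sub_smul_one_mul_self_eq_affine g a, htf, hde, neg_smul, sub_neg_eq_add]
  -- the affine frame socket (★ p851800) and the centre-trace bound (★ p851838)
  obtain ⟨β, e, γ', he, hβ, hdv, hdβ, htr, hγ', hγ'a, hS⟩ :=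
    exists_antidiag_companion_affine_frame_ncard_eq_of_unitary L v w hw hunr gGL g hcoe hgU hg10 hk
  have hβ0 : β ≠ 0 := fun h => by
    rw [h, map_zero] at hβ
    exact (Valuation.ne_zero_iff _).2 (pow_ne_zero _ h0) hβ.symm
  have hβa' := valuation_antidiagTrace_le_of_affine hϖ (galAdicCompletionMap (L := L) (IsCMField.complexConj L) hw) hσσ hσv hdβ hβ0 htr hdv hβ hf hj htf hde
  rw [hS]
  exact ncard_selfDualStable_antidiag_companion_affine_eq_sum_at L v w hw hunr hdv he hβ γ' hγ' haO hf hj hγ'a hβa'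

include hw in
/-- **THE COUNT AT THE PLACE `w` FOR A TYPE-(2) ELEMENT WITH AN ADMISSIBLE EISENSTEIN CENTRE** `γ₂ ∈ U(Φ₂)(L⁺_v)` in the stub frame (`hirr` at `w`; scalars
`(a, f, e′, j)`; NO `h2`, NO `hint`): `#S((Φ₂)_w, (γ₂)_w) = Σ_(k ≤ j) q_v^k`. [cite: Flicker1998UnitaryFL, §6 p. 97] [cite: Rogawski1990, §3.6 p. 31] -/
theorem ncard_selfDualStable_antidiagTwo_eq_sum_of_not_exists_isRoot_affine (hunr : Algebra.IsUnramifiedIn (𝓞 L) v.asIdeal)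
    (γH : (cmDatum L 2 (Matrix.of fun i j : Fin 2 => if i.val + j.val + 1 = 2 then (1 : L) else 0)).Local v × (cmDatum L 1 (Matrix.of fun i j : Fin 1 => if i.val + j.val + 1 = 1 then (1 : L) else 0)).Local v)
    (hirr : ¬ ∃ x : (w.1.adicCompletion L), (((((γH.1.val : GL (Fin 2) (LocalRing L v)) : Matrix (Fin 2) (Fin 2) (LocalRing L v)).map (Pi.evalRingHom (fun w' : PlacesOver L v => w'.1.adicCompletion L) w))).charpoly).IsRoot x)
    {a f e' : (w.1.adicCompletion L)} (haO : a ∈ 𝒪[(w.1.adicCompletion L)]) {j : ℕ}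
    (hf : valuation (w.1.adicCompletion L) f ≤ valuation (w.1.adicCompletion L) ((toPlace v w (GaloisRepresentations.HeckeCharacter.uniformizer ↥(maximalRealSubfield L) v : v.adicCompletion ↥(maximalRealSubfield L))) ^ (j + 1)))
    (hj : valuation (w.1.adicCompletion L) e' = valuation (w.1.adicCompletion L) ((toPlace v w (GaloisRepresentations.HeckeCharacter.uniformizer ↥(maximalRealSubfield L) v : v.adicCompletion ↥(maximalRealSubfield L))) ^ (2 * j + 1)))
    (htf : ((((γH.1.val : GL (Fin 2) (LocalRing L v)) : Matrix (Fin 2) (Fin 2) (LocalRing L v)).map (Pi.evalRingHom (fun w' : PlacesOver L v => w'.1.adicCompletion L) w))).trace - 2 * a = f) (hde : a * a - ((((γH.1.val : GL (Fin 2) (LocalRing L v)) : Matrix (Fin 2) (Fin 2) (LocalRing L v)).map (Pi.evalRingHom (fun w' : PlacesOver L v => w'.1.adicCompletion L) w))).trace * a + ((((γH.1.val : GL (Fin 2) (LocalRing L v)) : Matrix (Fin 2) (Fin 2) (LocalRing L v)).map (Pi.evalRingHom (fun w' : PlacesOver L v => w'.1.adicCompletion L) w))).det = -e') :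
    {Λ : Submodule 𝒪[(w.1.adicCompletion L)] (Fin 2 → (w.1.adicCompletion L)) |
        (∃ g : GL (Fin 2) (w.1.adicCompletion L), (∃ J' ∈ glInt 2 (w.1.adicCompletion L), (J' : Matrix (Fin 2) (Fin 2) (w.1.adicCompletion L)) =
            formCongr (galAdicCompletionMap (L := L) (IsCMField.complexConj L) hw) g (placeForm (Matrix.of fun i j : Fin 2 => if i.val + j.val + 1 = 2 then (1 : L) else 0) w.1)) ∧
          Λ = Submodule.span 𝒪[(w.1.adicCompletion L)] (Set.range ((g : Matrix (Fin 2) (Fin 2) (w.1.adicCompletion L)))ᵀ)) ∧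
        Λ.map ((Matrix.toLin' ((((localNonsplitEquiv (IsCMField.complexConj L) (Matrix.of fun i j : Fin 2 => if i.val + j.val + 1 = 2 then (1 : L) else 0) (IsCMField.complexConj_ne_one L) w hw γH.1 : unitaryGroupOfForm (galAdicCompletionMap (L := L) (IsCMField.complexConj L) hw) (placeForm (Matrix.of fun i j : Fin 2 => if i.val + j.val + 1 = 2 then (1 : L) else 0) w.1)) : GL (Fin 2) (w.1.adicCompletion L))) : Matrix (Fin 2) (Fin 2) (w.1.adicCompletion L))).restrictScalars 𝒪[(w.1.adicCompletion L)]) = Λ}.ncard =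
      ∑ k ∈ range (j + 1), Nat.card (𝓞 ↥(maximalRealSubfield L) ⧸ v.asIdeal) ^ k := by
  have hcoe : ((((localNonsplitEquiv (IsCMField.complexConj L) (Matrix.of fun i j : Fin 2 => if i.val + j.val + 1 = 2 then (1 : L) else 0) (IsCMField.complexConj_ne_one L) w hw γH.1 : unitaryGroupOfForm (galAdicCompletionMap (L := L) (IsCMField.complexConj L) hw) (placeForm (Matrix.of fun i j : Fin 2 => if i.val + j.val + 1 = 2 then (1 : L) else 0) w.1)) : GL (Fin 2) (w.1.adicCompletion L))) : Matrix (Fin 2) (Fin 2) (w.1.adicCompletion L)) = (((γH.1.val : GL (Fin 2) (LocalRing L v)) : Matrix (Fin 2) (Fin 2) (LocalRing L v)).map (Pi.evalRingHom (fun w' : PlacesOver L v => w'.1.adicCompletion L) w)) :=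
    coe_localNonsplitEquiv_apply L (Matrix.of fun i j : Fin 2 => if i.val + j.val + 1 = 2 then (1 : L) else 0) v w hw γH.1
  have hgU : (((((γH.1.val : GL (Fin 2) (LocalRing L v)) : Matrix (Fin 2) (Fin 2) (LocalRing L v)).map (Pi.evalRingHom (fun w' : PlacesOver L v => w'.1.adicCompletion L) w))).map (galAdicCompletionMap (L := L) (IsCMField.complexConj L) hw))ᵀ * (!![0, 1; 1, 0] : Matrix (Fin 2) (Fin 2) (w.1.adicCompletion L)) * (((γH.1.val : GL (Fin 2) (LocalRing L v)) : Matrix (Fin 2) (Fin 2) (LocalRing L v)).map (Pi.evalRingHom (fun w' : PlacesOver L v => w'.1.adicCompletion L) w)) = !![0, 1; 1, 0] := by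
    rw [← hcoe, ← placeForm_antidiagTwo_eq_aff L v w]
    exact (mem_unitaryGroupOfForm_iff (σ := (galAdicCompletionMap (L := L) (IsCMField.complexConj L) hw)) (J := placeForm (Matrix.of fun i j : Fin 2 => if i.val + j.val + 1 = 2 then (1 : L) else 0) w.1) (g := ((localNonsplitEquiv (IsCMField.complexConj L) (Matrix.of fun i j : Fin 2 => if i.val + j.val + 1 = 2 then (1 : L) else 0) (IsCMField.complexConj_ne_one L) w hw γH.1 : unitaryGroupOfForm (galAdicCompletionMap (L := L) (IsCMField.complexConj L) hw) (placeForm (Matrix.of fun i j : Fin 2 => if i.val + j.val + 1 = 2 then (1 : L) else 0) w.1)) : GL (Fin 2) (w.1.adicCompletion L)))).1 ((localNonsplitEquiv (IsCMField.complexConj L) (Matrix.of fun i j : Fin 2 => if i.val + j.val + 1 = 2 then (1 : L) else 0) (IsCMField.complexConj_ne_one L) w hw γH.1 : unitaryGroupOfForm (galAdicCompletionMap (L := L) (IsCMField.complexConj L) hw) (placeForm (Matrix.of fun i j : Fin 2 => if i.val + j.val + 1 = 2 then (1 : L) else 0) w.1))).2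
  -- `g₁₀ ≠ 0` (else `g₀₀` is a root of `χ_g`)
  have hg10 : ((((γH.1.val : GL (Fin 2) (LocalRing L v)) : Matrix (Fin 2) (Fin 2) (LocalRing L v)).map (Pi.evalRingHom (fun w' : PlacesOver L v => w'.1.adicCompletion L) w))) 1 0 ≠ 0 := fun h10 => hirr ⟨((((γH.1.val : GL (Fin 2) (LocalRing L v)) : Matrix (Fin 2) (Fin 2) (LocalRing L v)).map (Pi.evalRingHom (fun w' : PlacesOver L v => w'.1.adicCompletion L) w))) 0 0, by
    rw [Polynomial.IsRoot, Matrix.charpoly_fin_two, Matrix.trace_fin_two, Matrix.det_fin_two, h10]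
    simp; ring⟩
  exact ncard_selfDualStable_antidiagTwo_eq_sum_of_unitary_admissible L v w hw hunr _ _ hcoe hgU hg10 haO hf hj htf hde

end Value

/-! ## §4 The value: `Φ(⟦γ_H⟧, 1_{K_H}) = phiHtwo q j` -/

section Head

variable (L : Type) [Field L] [NumberField L] [IsCMField L] (v : HeightOneSpectrum (𝓞 ↥(maximalRealSubfield L)))
  (w : PlacesOver L v) (hw : IsCMField.complexConj L • w.1 = w.1)
  [MeasurableSpace ((cmDatum L 2 (Matrix.of fun i j : Fin 2 => if i.val + j.val + 1 = 2 then (1 : L) else 0)).Local v × (cmDatum L 1 (Matrix.of fun i j : Fin 1 => if i.val + j.val + 1 = 1 then (1 : L) else 0)).Local v)] [BorelSpace ((cmDatum L 2 (Matrix.of fun i j : Fin 2 => if i.val + j.val + 1 = 2 then (1 : L) else 0)).Local v × (cmDatum L 1 (Matrix.of fun i j : Fin 1 => if i.val + j.val + 1 = 1 then (1 : L) else 0)).Local v)]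
  [∀ a : (cmDatum L 2 (Matrix.of fun i j : Fin 2 => if i.val + j.val + 1 = 2 then (1 : L) else 0)).Local v × (cmDatum L 1 (Matrix.of fun i j : Fin 1 => if i.val + j.val + 1 = 1 then (1 : L) else 0)).Local v, MeasurableSpace (((cmDatum L 2 (Matrix.of fun i j : Fin 2 => if i.val + j.val + 1 = 2 then (1 : L) else 0)).Local v × (cmDatum L 1 (Matrix.of fun i j : Fin 1 => if i.val + j.val + 1 = 1 then (1 : L) else 0)).Local v) ⧸ Subgroup.centralizer ({a} : Set ((cmDatum L 2 (Matrix.of fun i j : Fin 2 => if i.val + j.val + 1 = 2 then (1 : L) else 0)).Local v × (cmDatum L 1 (Matrix.of fun i j : Fin 1 => if i.val + j.val + 1 = 1 then (1 : L) else 0)).Local v)))]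
  [∀ a : (cmDatum L 2 (Matrix.of fun i j : Fin 2 => if i.val + j.val + 1 = 2 then (1 : L) else 0)).Local v × (cmDatum L 1 (Matrix.of fun i j : Fin 1 => if i.val + j.val + 1 = 1 then (1 : L) else 0)).Local v, BorelSpace (((cmDatum L 2 (Matrix.of fun i j : Fin 2 => if i.val + j.val + 1 = 2 then (1 : L) else 0)).Local v × (cmDatum L 1 (Matrix.of fun i j : Fin 1 => if i.val + j.val + 1 = 1 then (1 : L) else 0)).Local v) ⧸ Subgroup.centralizer ({a} : Set ((cmDatum L 2 (Matrix.of fun i j : Fin 2 => if i.val + j.val + 1 = 2 then (1 : L) else 0)).Local v × (cmDatum L 1 (Matrix.of fun i j : Fin 1 => if i.val + j.val + 1 = 1 then (1 : L) else 0)).Local v)))]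
  (νH : Measure ((cmDatum L 2 (Matrix.of fun i j : Fin 2 => if i.val + j.val + 1 = 2 then (1 : L) else 0)).Local v × (cmDatum L 1 (Matrix.of fun i j : Fin 1 => if i.val + j.val + 1 = 1 then (1 : L) else 0)).Local v)) [νH.IsHaarMeasure] [νH.IsMulRightInvariant]

omit [IsCMField L] in
/-- `2 ≤ q_v`. [cite: NeukirchANT1999, Ch. I §3] -/
private theorem two_le_natCard_quotient_aff : 2 ≤ Nat.card (𝓞 ↥(maximalRealSubfield L) ⧸ v.asIdeal) := by
  classical
  haveI : Finite (𝓞 ↥(maximalRealSubfield L) ⧸ v.asIdeal) := Ideal.finiteQuotientOfFreeOfNeBot v.asIdeal v.ne_bot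
  haveI : Nontrivial (𝓞 ↥(maximalRealSubfield L) ⧸ v.asIdeal) := Ideal.Quotient.nontrivial_iff.2 v.isPrime.ne_top
  exact Finite.one_lt_card

include hw in
/-- **THE TYPE-(2) H-SIDE VALUE WITH AN ADMISSIBLE EISENSTEIN CENTRE — the `|2|`-free twin of ★ `classOrbitalIntegral_indicator_eq_phiHtwo_of_not_exists_isRoot`.**
At a finite place `v` non-split and unramified in `L` (ANY residue characteristic), `m_H` canonical for `(IsLocalGRegular, ν_H)`, `ν_H(K₂ ×ˢ K₁) = 1`; for
`γ_H = (γ₂, γ₁)` `G`-regular with `χ_{γ₂,w}` WITHOUT ROOT in `L_w` (type (2)) and an admissible Eisenstein centre `(a, f, e′, j)` of `(γ₂)_w` (`a ∈ 𝒪_w`,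
`tr − 2a = f`, `a² − tr·a + det = −e′`, `|f| ≤ |ϖ^(j+1)|`, `|e′| = |ϖ^(2j+1)|`), the centraliser of `γ₂` being compact:
`Φ(⟦γ_H⟧, 1_{K₂ ×ˢ K₁}) = phiHtwo q_v j = (q_v^(j+1) − 1)∕(q_v − 1)` (★ PAIR p840404 ∘ ★ lattice socket ∘ §3 ∘ `geom_sum_eq`).  At `v ∤ 2`: `a = tr∕2`, `f = 0`,
`e′ = (tr² − 4det)∕4`, `j = N`. [cite: Flicker1998UnitaryFL, §6 p. 97] [cite: Rogawski1990, §4.9 Prop. 4.9.1 (b) p. 55] -/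
theorem classOrbitalIntegral_indicator_eq_phiHtwo_of_not_exists_isRoot_affine (hunr : Algebra.IsUnramifiedIn (𝓞 L) v.asIdeal)
    {mH : OrbitalMeasureFamily ((cmDatum L 2 (Matrix.of fun i j : Fin 2 => if i.val + j.val + 1 = 2 then (1 : L) else 0)).Local v × (cmDatum L 1 (Matrix.of fun i j : Fin 1 => if i.val + j.val + 1 = 1 then (1 : L) else 0)).Local v)} (hmH : mH.IsCanonical (IsLocalGRegular L v) νH)
    (hνH : νH ((((cmLocalIntegralLevel L 2 (Matrix.of fun i j : Fin 2 => if i.val + j.val + 1 = 2 then (1 : L) else 0) v).prod (cmLocalIntegralLevel L 1 (Matrix.of fun i j : Fin 1 => if i.val + j.val + 1 = 1 then (1 : L) else 0) v)) : Subgroup ((cmDatum L 2 (Matrix.of fun i j : Fin 2 => if i.val + j.val + 1 = 2 then (1 : L) else 0)).Local v × (cmDatum L 1 (Matrix.of fun i j : Fin 1 => if i.val + j.val + 1 = 1 then (1 : L) else 0)).Local v)) : Set ((cmDatum L 2 (Matrix.of fun i j : Fin 2 => if i.val + j.val + 1 = 2 then (1 : L) else 0)).Local v × (cmDatum L 1 (Matrix.of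 fun i j : Fin 1 => if i.val + j.val + 1 = 1 then (1 : L) else 0)).Local v)) = 1)
    {γH : (cmDatum L 2 (Matrix.of fun i j : Fin 2 => if i.val + j.val + 1 = 2 then (1 : L) else 0)).Local v × (cmDatum L 1 (Matrix.of fun i j : Fin 1 => if i.val + j.val + 1 = 1 then (1 : L) else 0)).Local v} (hreg : IsLocalGRegular L v γH)
    [CompactSpace (Subgroup.centralizer ({γH.1} : Set ((cmDatum L 2 (Matrix.of fun i j : Fin 2 => if i.val + j.val + 1 = 2 then (1 : L) else 0)).Local v)))]
    (hirr : ¬ ∃ x : (w.1.adicCompletion L), (((((γH.1.val : GL (Fin 2) (LocalRing L v)) : Matrix (Fin 2) (Fin 2) (LocalRing L v)).map (Pi.evalRingHom (fun w' : PlacesOver L v => w'.1.adicCompletion L) w))).charpoly).IsRoot x)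
    {a f e' : (w.1.adicCompletion L)} (haO : a ∈ 𝒪[(w.1.adicCompletion L)]) {j : ℕ}
    (hf : valuation (w.1.adicCompletion L) f ≤ valuation (w.1.adicCompletion L) ((toPlace v w (GaloisRepresentations.HeckeCharacter.uniformizer ↥(maximalRealSubfield L) v : v.adicCompletion ↥(maximalRealSubfield L))) ^ (j + 1)))
    (hj : valuation (w.1.adicCompletion L) e' = valuation (w.1.adicCompletion L) ((toPlace v w (GaloisRepresentations.HeckeCharacter.uniformizer ↥(maximalRealSubfield L) v : v.adicCompletion ↥(maximalRealSubfield L))) ^ (2 * j + 1)))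
    (htf : ((((γH.1.val : GL (Fin 2) (LocalRing L v)) : Matrix (Fin 2) (Fin 2) (LocalRing L v)).map (Pi.evalRingHom (fun w' : PlacesOver L v => w'.1.adicCompletion L) w))).trace - 2 * a = f) (hde : a * a - ((((γH.1.val : GL (Fin 2) (LocalRing L v)) : Matrix (Fin 2) (Fin 2) (LocalRing L v)).map (Pi.evalRingHom (fun w' : PlacesOver L v => w'.1.adicCompletion L) w))).trace * a + ((((γH.1.val : GL (Fin 2) (LocalRing L v)) : Matrix (Fin 2) (Fin 2) (LocalRing L v)).map (Pi.evalRingHom (fun w' : PlacesOver L v => w'.1.adicCompletion L) w))).det = -e') :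
    classOrbitalIntegral mH (((((cmLocalIntegralLevel L 2 (Matrix.of fun i j : Fin 2 => if i.val + j.val + 1 = 2 then (1 : L) else 0) v).prod (cmLocalIntegralLevel L 1 (Matrix.of fun i j : Fin 1 => if i.val + j.val + 1 = 1 then (1 : L) else 0) v)) : Subgroup ((cmDatum L 2 (Matrix.of fun i j : Fin 2 => if i.val + j.val + 1 = 2 then (1 : L) else 0)).Local v × (cmDatum L 1 (Matrix.of fun i j : Fin 1 => if i.val + j.val + 1 = 1 then (1 : L) else 0)).Local v)) : Set ((cmDatum L 2 (Matrix.of fun i j : Fin 2 => if i.val + j.val + 1 = 2 then (1 : L) else 0)).Local v × (cmDatum L 1 (Matrix.of fun i j : Fin 1 => if i.val + j.val + 1 = 1 then (1 : L) else 0)).Local v)).indicator fun _ => (1 : ℂ)) (ConjClasses.mk γH) = ((Flicker1998.phiHtwo (Ideal.absNorm v.asIdeal) j : ℚ) : ℂ) := by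
  have hcount := ncard_selfDualStable_antidiagTwo_eq_sum_of_not_exists_isRoot_affine L v w hw hunr γH hirr haO hf hj htf hde
  have hq2 := two_le_natCard_quotient_aff L v
  refine (classOrbitalIntegral_indicator_complex_cmLocalIntegralLevel_prod_eq_natCard_fixedBy_fst L v νH hmH hνH γH hreg w hw).trans ?_
  rw [natCard_fixedBy_eq_ncard_selfDualStable_antidiagTwo L v w hw hunr γH.1, hcount, Flicker1998.phiHtwo, Ideal.absNorm_apply, Submodule.cardQuot_apply]
  have hq1 : ((Nat.card (𝓞 ↥(maximalRealSubfield L) ⧸ v.asIdeal) : ℚ)) ≠ 1 := by exact_mod_cast (show Nat.card (𝓞 ↥(maximalRealSubfield L) ⧸ v.asIdeal) ≠ 1 by omega)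
  rw [← geom_sum_eq hq1 (j + 1)]
  push_cast
  rfl

end Head

end Literature.NumberTheory.Automorphic.UnitaryGroup
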